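import Literature.Analysis.FluidPDE.NSLerayHopfSereginProofs
import Literature.Analysis.FluidPDE.NSLerayHopfProofs
import HarnessLib

/-!
# Seregin's `L³` blow-up criterion — re-threading through the ESS and Leray facts

Analysis/FluidPDE proof file (theorems only; **no definitions, no named facts**) in the
decomposition of **ns.S08** `Literature.Analysis.FluidPDE.seregin_L3_blowup` (Seregin 2012,
Comm. Math. Phys. 312, Thm. 1.1; `NSLerayHopf.lean`). The accepted assembly
`seregin_L3_blowup_of_facts` (`NSLerayHopfSereginProofs.lean`) reduces the tree's statement to
two named facts: the deep `seregin_L3_blowup_mild` (Lemarié-Rieusset 2016, Thm. 15.5 = Seregin's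
theorem for mild solutions with `L³` data) and `mild_L3_smooth` (parabolic smoothing of Kato's
mild `C_t L³` solutions; since discharged, `mild_L3_smooth_holds`, `MildL3SmoothHolds.lean`). The
second fact is used at one place only — step (iii) of that proof: a mild `C([0, T'); L³)`
continuation `v` of `u`, `T' > T`, must contradict the maximality of the smooth solution `(u, p)`.

Step (iii) needs much less than smoothing: by uniqueness in `C([0,T); L³)` (**ns.S13**
`kato_unique_holds`) such a `v` agrees with `u` on `[0, T)`, so `‖u(t)‖₃ = ‖v(t)‖₃` stays
**bounded up to `T`** (`v` is `L³`-continuous on the compact `[0, T] ⊂ [0, T')`) — exactly what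
the `limsup` theorem of Escauriaza–Seregin–Šverák excludes (ESS 2003, Thm. 1.3; (1.6) in Seregin
2012, p. 2: "a weaker statement, `limsup_{t→T-0} ‖v(·,t)‖₃ = ∞`, has been proven in [ESS2003]").
Hence (all proved):

* `ess_limsup_L3_of_ess_sup_bound` — the ESS `limsup` criterion in the tree's maximal-smooth
  form (the hypotheses of `seregin_L3_blowup` verbatim; conclusion: `‖u(t)‖₃` is unbounded on
  every `(T', T)`, `0 ≤ T' < T`, i.e. `limsup_{t↑T} ‖u(t)‖₃ = ∞`) **from `ess_sup_bound` and
  `leray_blowup_rate_top`** (Escauriaza–Seregin–Šverák 2003, §3 (3.5)–(3.6); Leray 1934, §20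
  (3.9)): if `‖u(t)‖₃ ≤ M` on `(T', T)` then `u ∈ L^∞(0, T; L³)` (on `[0, T']` the slices are
  bounded and of finite energy, `‖w‖₃³ ≤ ‖w‖_∞ ‖w‖₂²`), so by ESS (3.5)–(3.6) (`ess_sup_bound`,
  `NSLerayHopfProofs.lean`, shared with the decomposition of `ess_endpoint`) `‖u(t)‖_∞ ≤ C` for
  a.e. `t ∈ (T/2, T)`; but Leray's first character of irregularity (`leray_blowup_rate_top`,
  **ns.S28**, Leray 1934, §20 (3.9); discharged downstream, `leray_blowup_rate_top_holds`,
  `NSLerayBlowupRateTopHolds.lean`) gives `‖u(t)‖_∞ ≥ c √ν (T - t)^{-1/2}` for *every* `t < T` —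
  absurd at a.e. time `t` with `T - t < (c√ν/(C+1))²`.
* `seregin_L3_blowup_of_limsup` — for ONE maximal smooth solution as in `seregin_L3_blowup`:
  `seregin_L3_blowup_mild` and the unboundedness of `‖u(t)‖₃` on `(0, T)` give the genuine limit
  `‖u(t)‖₃ → ∞` (real proof: steps (i), (ii), (iv) of `seregin_L3_blowup_of_mild` unchanged,
  step (iii) as above) — `mild_L3_smooth` is not needed.
* `ess_limsup_L3_of_seregin` — conversely the `lim` statement `seregin_L3_blowup` implies the
  `limsup` statement (Seregin 2012, (1.7) ⇒ (1.6)); with `seregin_L3_blowup_holds` this becomes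
  the unconditional ESS `limsup` criterion in the tree's form.
* `seregin_L3_blowup_of_ess : seregin_L3_blowup_mild → ess_sup_bound → leray_blowup_rate_top →
  seregin_L3_blowup` — besides the deep core (Thm. 15.5) it uses only facts that are already
  load-bearing elsewhere in the tree (`ess_sup_bound` for `ess_endpoint` and for
  `hasSmoothExtensionPast_of_eLpNorm_three_bounded`; `leray_blowup_rate_top` for the latter).

**Merge note (D-0026 review, 2026-08-15; no statement of the tree changed).** An earlier version
of this file minted the `limsup` criterion as a named fact `ess_limsup_L3 : Prop`. As a
decomposition child of `seregin_L3_blowup` it was the parent's own statement weakened (`lim` ↦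
`limsup`, cf. the docstring of `seregin_L3_blowup`) and not provable short of ESS 2003, Thm. 1.4
(`ess_local_holder`, through `ess_sup_bound_of_local_holder`); it has been merged back: the
statement now occurs only as the *conclusion* of the proved theorems
`ess_limsup_L3_of_ess_sup_bound` and `ess_limsup_L3_of_seregin`, and as the (single-solution)
hypothesis of `seregin_L3_blowup_of_limsup`. The exported reductions `seregin_L3_blowup_of_ess`,
`seregin_L3_blowup_of_ess_and` and the glue lemma `exists_eLpNorm_three_le_Icc` are unchanged.
What remains for `seregin_L3_blowup_holds` on this route: the discharge of
`seregin_L3_blowup_mild` (Lemarié-Rieusset 2016, pp. 570–573) and of `ess_sup_bound` (ESS 2003,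
Thm. 1.4 + Lemma 2.2 + (3.2)–(3.4)); on the sibling route `seregin_L3_blowup_of_seregin_mild`
(`MildL3SmoothHolds.lean`) the first alone.

## References

* G. Seregin, Comm. Math. Phys. 312 (2012), 833–845 = arXiv:1104.3615: Thm. 1.1, (1.6), §2 (2.1).
* L. Escauriaza, G. Seregin, V. Šverák, Russ. Math. Surveys 58:2 (2003): Thm. 1.3, §3 (3.5)–(3.6).
* J. Leray, Acta Math. 63 (1934), §20 (3.9) ("premier caractère des irrégularités").
* P. G. Lemarié-Rieusset, *The Navier–Stokes problem in the 21st century* (2016), Thm. 15.5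
  (PDF p. 570), proof pp. 570–573; Thm. 7.7 (uniqueness in `C([0,T); L³)`).
-/

noncomputable section

open MeasureTheory TopologicalSpace Set Function Filter Topology
open scoped InnerProductSpace RealInnerProductSpace ENNReal NNReal

namespace Literature.Analysis.FluidPDE

/-! ### The `lim` statement implies the `limsup` statement -/

/-- **Escauriaza–Seregin–Šverák's `limsup` criterion from Seregin's `lim` criterion**
(Seregin 2012, p. 2, (1.6)–(1.7): "for the critical case `m = 3` a weaker statement
`limsup_{t→T-0} ‖v(·, t)‖₃ = ∞` has been proven in [ESS2003]", of which Thm. 1.1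
(`seregin_L3_blowup`, a genuine limit) is the sharpening; Escauriaza–Seregin–Šverák 2003, Russ.
Math. Surveys 58, Thm. 1.3). Rendering of the `limsup` statement, with exactly the hypotheses of
the tree's `seregin_L3_blowup`: let `ν > 0` and let `(u, p)` be a maximal smooth solution of the
unforced system on `ℝ³ × [0, T)`, `0 < T < ∞` (`IsMaximalSmoothSolution`: classical on `[0, T)`,
no classical continuation past `T`), which is a Leray–Hopf solution on `[0, T)` from its datum
`u(0) ∈ L² ∩ L³` and essentially bounded on every closed sub-strip `[0, T'] × ℝ³`, `T' < T`. Then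
`limsup_{t ↑ T} ‖u(t)‖₃ = ∞`: for every `M` and every `T' ∈ [0, T)` there is `t ∈ (T', T)` with
`‖u(t)‖₃ > M`. Trivial from the limit: eventually `‖u(t)‖₃ > M` as `t ↑ T`, and `(T', T)` is a
left neighbourhood of `T`. [cite: Seregin2012CMP, (1.6)–(1.7)] [cite: EscauriazaSereginSverak2003, Thm. 1.3] -/
theorem ess_limsup_L3_of_seregin (hS : seregin_L3_blowup) {ν T : ℝ} (hν : 0 < ν) (hT : 0 < T)
    {u : ℝ → EuclideanSpace ℝ (Fin 3) → EuclideanSpace ℝ (Fin 3)}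
    {p : ℝ → EuclideanSpace ℝ (Fin 3) → ℝ}
    (hmax : FluidPDE.IsMaximalSmoothSolution ν 0 u p T)
    (hlh : FluidPDE.IsLerayHopfOn T ν 0 (u 0) u) (h₃ : MemLp (u 0) 3 volume)
    (hbdd : ∀ T' ∈ Ioo 0 T, eLpNorm (uncurry u) ∞ (volume.restrict (Icc 0 T' ×ˢ univ)) < ∞)
    (M : ℝ≥0) {T' : ℝ} (hT' : T' ∈ Ico 0 T) :
    ∃ t ∈ Ioo T' T, (M : ℝ≥0∞) < eLpNorm (u t) 3 volume := by
  have hlim := hS hν hT hmax hlh h₃ hbdd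
  -- eventually `‖u t‖₃ > M` as `t ↑ T`, and `(T', T)` is a left neighbourhood of `T`
  have hev : ∀ᶠ t in 𝓝[<] T, (M : ℝ≥0∞) < eLpNorm (u t) 3 volume :=
    hlim (lt_mem_nhds ENNReal.coe_lt_top)
  have hmem : ∀ᶠ t in 𝓝[<] T, t ∈ Ioo T' T := Ioo_mem_nhdsLT hT'.2
  obtain ⟨t, ht, htmem⟩ := (hev.and hmem).exists
  exact ⟨t, htmem, ht⟩

/-! ### Glue: slices of a continuous field, bounds in `L³` -/

section Glue

variable {u : ℝ → EuclideanSpace ℝ (Fin 3) → EuclideanSpace ℝ (Fin 3)}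

/-- **`L³` bound on a closed sub-strip** for a continuous field which is essentially bounded on
closed sub-strips and has slices of bounded `L²` norm: `‖u(t)‖₃³ ≤ ‖u(t)‖_∞ ‖u(t)‖₂²`
(`eLpNorm_three_pow_le`), with the pointwise bound of `exists_bound_Icc_of_eLpNorm_top`. [folklore] -/
theorem exists_eLpNorm_three_le_Icc {T T' : ℝ} (hT' : T' ∈ Ioo 0 T)
    (hcont : ContinuousOn (uncurry u) (Ico 0 T ×ˢ univ))
    (hbdd : ∀ T'' ∈ Ioo 0 T, eLpNorm (uncurry u) ∞
      ((volume : Measure (ℝ × EuclideanSpace ℝ (Fin 3))).restrict (Icc 0 T'' ×ˢ univ)) < ∞)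
    {C₀ : ℝ≥0∞} (hC₀ : C₀ ≠ ∞) (hE : ∀ t ∈ Icc 0 T', eLpNorm (u t) 2 volume ≤ C₀) :
    ∃ M : ℝ≥0, ∀ t ∈ Icc 0 T', eLpNorm (u t) 3 volume ≤ M := by
  obtain ⟨B, hB⟩ := exists_bound_Icc_of_eLpNorm_top hT' hcont hbdd
  have hslice : ∀ t ∈ Icc 0 T', AEStronglyMeasurable (u t) volume := by
    intro t ht
    have h1 : ContinuousOn
        (fun x : EuclideanSpace ℝ (Fin 3) => uncurry u ((t, x) : ℝ × EuclideanSpace ℝ (Fin 3)))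
        univ :=
      hcont.comp (continuous_const.prodMk continuous_id).continuousOn
        (fun x _ => ⟨⟨ht.1, ht.2.trans_lt hT'.2⟩, mem_univ x⟩)
    exact (continuousOn_univ.1 h1).aestronglyMeasurable
  set K : ℝ≥0∞ := (ENNReal.ofReal B * C₀ ^ 2) ^ (3⁻¹ : ℝ) with hK
  have hKtop : K ≠ ∞ := by
    refine ENNReal.rpow_ne_top_of_nonneg (by norm_num) ?_
    exact ENNReal.mul_ne_top ENNReal.ofReal_ne_top (ENNReal.pow_ne_top hC₀)
  refine ⟨K.toNNReal, fun t ht => ?_⟩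
  rw [ENNReal.coe_toNNReal hKtop]
  have hle : eLpNorm (u t) 3 volume ^ 3 ≤ ENNReal.ofReal B * C₀ ^ 2 :=
    (eLpNorm_three_pow_le (hslice t ht)).trans (by
      gcongr
      exacts [eLpNorm_top_le_of_bound (hB t ht), hE t ht])
  rw [hK, ENNReal.le_rpow_inv_iff (by norm_num : (0 : ℝ) < 3)]
  exact_mod_cast (ENNReal.rpow_natCast _ 3).symm ▸ hle

end Glue

/-! ### The ESS `limsup` criterion from ESS (3.6) and Leray's rate -/

/-- **Escauriaza–Seregin–Šverák, the `limsup` form of the `L³` blow-up criterion, from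
`ess_sup_bound` and `leray_blowup_rate_top`** (Escauriaza–Seregin–Šverák 2003, Russ. Math.
Surveys 58, Thm. 1.3: a Leray–Hopf solution of the Cauchy problem with `v ∈ L_{3,∞}(Q_T)` is
smooth (and unique) in `Q_T`, hence `T` is not a blow-up time — recorded in this form as (1.6) of
Seregin 2012, p. 2: "for the critical case `m = 3` a weaker statement
`limsup_{t→T-0} ‖v(·, t)‖₃ = ∞` has been proven in [ESS2003]"; proof through §3, (3.5)–(3.6) of
ESS 2003 and Leray 1934, §20 (3.9)). Statement, with exactly the hypotheses of the tree's
`seregin_L3_blowup` (as in `ess_limsup_L3_of_seregin`): for a maximal smooth solution `(u, p)` on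
`ℝ³ × [0, T)` which is Leray–Hopf from `u(0) ∈ L² ∩ L³` and essentially bounded on closed
sub-strips, `‖u(t)‖₃` is unbounded on every `(T', T)`, `0 ≤ T' < T`. Proof: if `‖u(t)‖₃ ≤ M` on
`(T', T)`, then together with the bound on the closed sub-strip `[0, T']` (continuity, essential
boundedness and finite energy: `exists_eLpNorm_three_le_Icc`) `u ∈ L^∞(0, T; L³)`; ESS (3.6)
makes `u` essentially bounded on `ℝ³ × (T/2, T)`, i.e. `‖u(t)‖_∞ ≤ C` for a.e. `t ∈ (T/2, T)`,
whereas Leray's rate gives `‖u(t)‖_∞ ≥ c √ν / √(T - t)` for every `t < T`; at a.e. time `t` with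
`T - t < (c √ν / (C+1))²` both cannot hold. Real proof. [cite: EscauriazaSereginSverak2003, Thm. 1.3 and §3 (3.5)–(3.6)] [cite: Seregin2012CMP, (1.6)] [cite: Leray1934, §20 (3.9)] -/
theorem ess_limsup_L3_of_ess_sup_bound (h36 : ess_sup_bound) (hL : leray_blowup_rate_top)
    {ν T : ℝ} (hν : 0 < ν) (hT : 0 < T)
    {u : ℝ → EuclideanSpace ℝ (Fin 3) → EuclideanSpace ℝ (Fin 3)}
    {p : ℝ → EuclideanSpace ℝ (Fin 3) → ℝ}
    (hmax : FluidPDE.IsMaximalSmoothSolution ν 0 u p T)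
    (hlh : FluidPDE.IsLerayHopfOn T ν 0 (u 0) u) (h₃ : MemLp (u 0) 3 volume)
    (hbdd : ∀ T' ∈ Ioo 0 T, eLpNorm (uncurry u) ∞ (volume.restrict (Icc 0 T' ×ˢ univ)) < ∞)
    (M : ℝ≥0) {T' : ℝ} (hT' : T' ∈ Ico 0 T) :
    ∃ t ∈ Ioo T' T, (M : ℝ≥0∞) < eLpNorm (u t) 3 volume := by
  by_contra hcon
  push Not at hcon
  have hcl : FluidPDE.IsClassicalNSSolutionOn (Ico 0 T) ν 0 u p := hmax.1
  have hcont : ContinuousOn (uncurry u) (Ico 0 T ×ˢ univ) := hcl.smooth_velocity.continuousOn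
  have hslice : ∀ t ∈ Ico 0 T, AEStronglyMeasurable (u t) volume := fun t ht =>
    (hcl.contDiff_velocity ht).continuous.aestronglyMeasurable
  have hdiv0 : FluidPDE.IsWeaklyDivFree (u 0) := hlh.isWeaklyDivFree_datum hT
  have hu02 : MemLp (u 0) 2 volume := hlh.memLp 0 ⟨le_rfl, hT.le⟩
  -- ### an `L³` bound on the whole of `[0, T)`
  set C₀ : ℝ≥0∞ := ENNReal.ofReal (2 * VectorCalculus.kineticEnergy (u 0)) ^ (2⁻¹ : ℝ) with hC₀
  have hC₀top : C₀ ≠ ∞ := ENNReal.rpow_ne_top_of_nonneg (by norm_num) ENNReal.ofReal_ne_top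
  have hE : ∀ t ∈ Icc 0 T, eLpNorm (u t) 2 volume ≤ C₀ := fun t ht =>
    eLpNorm_two_le_of_isLerayHopfOn hν.le hlh ht
  obtain ⟨M₀, hM₀⟩ : ∃ M₀ : ℝ≥0, ∀ t ∈ Ico 0 T, eLpNorm (u t) 3 volume ≤ M₀ := by
    rcases hT'.1.eq_or_lt with h0 | hpos
    · -- `T' = 0`: the bound `M` on `(0, T)` and the slice `t = 0`
      have h3top : eLpNorm (u 0) 3 volume ≠ ∞ := h₃.eLpNorm_ne_top
      refine ⟨max M (eLpNorm (u 0) 3 volume).toNNReal, fun t ht => ?_⟩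
      rcases ht.1.eq_or_lt with ht0 | htpos
      · rw [← ht0, ENNReal.coe_max, ENNReal.coe_toNNReal h3top]
        exact le_max_right _ _
      · rw [ENNReal.coe_max]
        exact (hcon t ⟨h0 ▸ htpos, ht.2⟩).trans (le_max_left _ _)
    · -- `0 < T'`: the closed sub-strip `[0, T']` and the bound `M` on `(T', T)`
      obtain ⟨M₁, hM₁⟩ := exists_eLpNorm_three_le_Icc ⟨hpos, hT'.2⟩ hcont hbdd hC₀top
        (fun t ht => hE t ⟨ht.1, ht.2.trans hT'.2.le⟩)
      refine ⟨max M M₁, fun t ht => ?_⟩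
      rw [ENNReal.coe_max]
      rcases le_or_gt t T' with htle | htgt
      · exact (hM₁ t ⟨ht.1, htle⟩).trans (le_max_right _ _)
      · exact (hcon t ⟨htgt, ht.2⟩).trans (le_max_left _ _)
  -- ### `u ∈ L^∞(0, T; L³)`
  have hmem3 : ∀ t ∈ Ico 0 T, MemLp (u t) 3 volume := fun t ht =>
    ⟨hslice t ht, (hM₀ t ht).trans_lt ENNReal.coe_lt_top⟩
  have h3 : FluidPDE.MemLqLp ∞ 3 u (Ioo 0 T) := by
    refine FluidPDE.memLqLp_of_ae_eLpNorm_le (C := (M₀ : ℝ≥0∞)) ENNReal.coe_ne_top ?_ ?_ ?_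
    · rw [Real.volume_Ioo]; exact ENNReal.ofReal_ne_top
    · exact (ae_restrict_iff' measurableSet_Ioo).2 (Eventually.of_forall fun t ht =>
        hmem3 t (Ioo_subset_Ico_self ht))
    · exact (ae_restrict_iff' measurableSet_Ioo).2 (Eventually.of_forall fun t ht =>
        hM₀ t (Ioo_subset_Ico_self ht))
  -- ### ESS (3.6): essential boundedness on `ℝ³ × (T/2, T)`
  have hT2 : T / 2 ∈ Ioo 0 T := ⟨by linarith, by linarith⟩
  obtain ⟨haeTop, hnorm⟩ := h36 hν hT hu02 hdiv0 hlh h3 (T / 2) hT2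
  set g : ℝ → ℝ := fun t => (eLpNorm (u t) ∞ volume).toReal with hg
  set K : ℝ≥0∞ := eLpNormEssSup g (volume.restrict (Ioo (T / 2) T)) with hK
  have hKtop : K ≠ ∞ := by
    have := hnorm
    rw [FluidPDE.eLqLpNorm_def, eLpNorm_exponent_top] at this
    exact this.ne
  set C : ℝ := K.toReal with hC
  have hC0 : 0 ≤ C := ENNReal.toReal_nonneg
  have hbound : ∀ᵐ t ∂(volume.restrict (Ioo (T / 2) T)),
      eLpNorm (u t) ∞ volume ≤ ENNReal.ofReal C := by
    have h1 := ae_le_eLpNormEssSup (f := g) (μ := volume.restrict (Ioo (T / 2) T))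
    filter_upwards [h1, haeTop] with t ht htmem
    have hfin : eLpNorm (u t) ∞ volume ≠ ∞ := htmem.eLpNorm_ne_top
    have hgt : g t ≤ C := by
      have h2 : ‖g t‖ₑ ≤ K := ht
      rw [Real.enorm_eq_ofReal ENNReal.toReal_nonneg] at h2
      exact (ENNReal.ofReal_le_iff_le_toReal hKtop).1 h2
    calc eLpNorm (u t) ∞ volume = ENNReal.ofReal (g t) := (ENNReal.ofReal_toReal hfin).symm
      _ ≤ ENNReal.ofReal C := ENNReal.ofReal_le_ofReal hgt
  -- ### Leray's rate
  obtain ⟨c, hc, hrate⟩ := hL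
  have hrate' : ∀ t ∈ Ico 0 T,
      ENNReal.ofReal (c * Real.sqrt ν / Real.sqrt (T - t)) ≤ eLpNorm (u t) ∞ volume :=
    hrate ν T hν hT u p hmax hlh hbdd
  -- ### a time close to `T` at which both bounds hold
  set a : ℝ := c * Real.sqrt ν with ha
  have ha0 : 0 < a := mul_pos hc (Real.sqrt_pos.2 hν)
  set s₀ : ℝ := (a / (C + 1)) ^ 2 with hs₀
  have hs₀0 : 0 < s₀ := by positivity
  set T₁ : ℝ := max (T / 2) (T - s₀) with hT₁
  have hT₁T : T₁ < T := max_lt (by linarith) (by linarith)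
  have hT₁pos : 0 < T₁ := lt_of_lt_of_le (by linarith) (le_max_left _ _)
  have hsub : Ioo T₁ T ⊆ Ioo (T / 2) T := Ioo_subset_Ioo (le_max_left _ _) le_rfl
  have hbound' : ∀ᵐ t ∂(volume.restrict (Ioo T₁ T)),
      eLpNorm (u t) ∞ volume ≤ ENNReal.ofReal C :=
    ae_restrict_of_ae_restrict_of_subset hsub hbound
  have hpos : (volume : Measure ℝ) (Ioo T₁ T) ≠ 0 := by
    rw [Real.volume_Ioo]
    exact (ENNReal.ofReal_pos.2 (by linarith)).ne'
  haveI : (ae ((volume : Measure ℝ).restrict (Ioo T₁ T))).NeBot := by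
    rw [ae_neBot]
    intro h0
    exact hpos (Measure.restrict_eq_zero.1 h0)
  obtain ⟨t, htb, htmem⟩ :=
    (hbound'.and (ae_restrict_mem (measurableSet_Ioo (a := T₁) (b := T)))).exists
  -- at `t`: `ofReal (a / √(T - t)) ≤ ‖u t‖_∞ ≤ ofReal C`, with `T - t < s₀`
  have htIco : t ∈ Ico 0 T := ⟨(hT₁pos.trans htmem.1).le, htmem.2⟩
  have hle : ENNReal.ofReal (a / Real.sqrt (T - t)) ≤ ENNReal.ofReal C :=
    (hrate' t htIco).trans htb
  have hle' : a / Real.sqrt (T - t) ≤ C := (ENNReal.ofReal_le_ofReal_iff hC0).1 hle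
  have hTt : 0 < T - t := by linarith [htmem.2]
  have hTt' : T - t < s₀ := by
    have : T - s₀ ≤ T₁ := le_max_right _ _
    linarith [htmem.1]
  have hsqrt : Real.sqrt (T - t) < a / (C + 1) := by
    rw [Real.sqrt_lt' (by positivity)]
    exact hTt'
  have hsqrt0 : 0 < Real.sqrt (T - t) := Real.sqrt_pos.2 hTt
  have hgt : C + 1 < a / Real.sqrt (T - t) := by
    rw [lt_div_iff₀ hsqrt0]
    calc (C + 1) * Real.sqrt (T - t) < (C + 1) * (a / (C + 1)) := by gcongr
      _ = a := by field_simp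
  linarith

/-! ### The assembly through the `limsup` criterion -/

/-- **Seregin's limit for one solution, from Lemarié-Rieusset's Thm. 15.5 and the unboundedness
of `‖u(t)‖₃`** (Lemarié-Rieusset 2016, Thm. 15.5; Seregin 2012, Thm. 1.1 and (1.6);
Escauriaza–Seregin–Šverák 2003, Thm. 1.3; with the proved bridging theorems
`isMildNSSolutionOn_of_isLerayHopfOn_holds` (Fabes–Jones–Rivière 1972, Thm. 2.1),
`continuousInLpOn_two_of_serrin` (Sather–Serrin) and **ns.S13** `kato_unique_holds`
(Furioli–Lemarié-Rieusset–Terraneo 2000)). Let `(u, p)` be a maximal smooth solution on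
`ℝ³ × [0, T)` as in `seregin_L3_blowup` and suppose `‖u(t)‖₃` is unbounded on `(0, T)` (the
`limsup` criterion for this solution, e.g. `ess_limsup_L3_of_ess_sup_bound`). Then
`‖u(t)‖₃ → ∞` as `t ↑ T`, granted `seregin_L3_blowup_mild`. Steps (i), (ii), (iv) as in
`seregin_L3_blowup_of_mild`; step (iii) — `T` is the maximal existence time of `u` as a mild
`C_t L³` solution — without any smoothing: a mild `C([0, T'); L³)` solution `v` from `u(0)` with
`T' > T` agrees with `u` a.e. on `[0, T)` (`kato_unique_holds`), so
`‖u(t)‖₃ = ‖v(t)‖₃ ≤ sup_{[0,T]} ‖v‖₃ < ∞` on `[0, T)` (`ContinuousInLpOn.exists_forall_eLpNorm_le`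
on the compact `[0, T] ⊆ [0, T')`), contradicting the unboundedness. Real proof. [cite: LemarieRieusset2016, Thm. 15.5] [cite: Seregin2012CMP, Thm. 1.1 and (1.6)] -/
theorem seregin_L3_blowup_of_limsup (h15 : seregin_L3_blowup_mild) {ν T : ℝ} (hν : 0 < ν)
    (hT : 0 < T) {u : ℝ → EuclideanSpace ℝ (Fin 3) → EuclideanSpace ℝ (Fin 3)}
    {p : ℝ → EuclideanSpace ℝ (Fin 3) → ℝ}
    (hmax : FluidPDE.IsMaximalSmoothSolution ν 0 u p T)
    (hlh : FluidPDE.IsLerayHopfOn T ν 0 (u 0) u) (h₃ : MemLp (u 0) 3 volume)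
    (hbdd : ∀ T' ∈ Ioo 0 T, eLpNorm (uncurry u) ∞ (volume.restrict (Icc 0 T' ×ˢ univ)) < ∞)
    (h16 : ∀ M : ℝ≥0, ∃ t ∈ Ioo 0 T, (M : ℝ≥0∞) < eLpNorm (u t) 3 volume) :
    Tendsto (fun t => eLpNorm (u t) 3 volume) (𝓝[<] T) (𝓝 ∞) := by
  have hcl : FluidPDE.IsClassicalNSSolutionOn (Ico 0 T) ν 0 u p := hmax.1
  have hcont : ContinuousOn (uncurry u) (Ico 0 T ×ˢ univ) := hcl.smooth_velocity.continuousOn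
  have hslice : ∀ t ∈ Ico 0 T, AEStronglyMeasurable (u t) volume := fun t ht =>
    (hcl.contDiff_velocity ht).continuous.aestronglyMeasurable
  have hdiv0 : FluidPDE.IsWeaklyDivFree (u 0) := hlh.isWeaklyDivFree_datum hT
  have hu02 : MemLp (u 0) 2 volume := hlh.memLp 0 ⟨le_rfl, hT.le⟩
  -- (i) pointwise bounds on closed sub-strips and the `L²` bound
  have hbound : ∀ T' ∈ Ioo 0 T, ∃ M : ℝ, ∀ t ∈ Icc 0 T', ∀ x, ‖u t x‖ ≤ M := fun T' hT' =>
    exists_bound_Icc_of_eLpNorm_top hT' hcont hbdd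
  set C₀ : ℝ≥0∞ := ENNReal.ofReal (2 * VectorCalculus.kineticEnergy (u 0)) ^ (2⁻¹ : ℝ) with hC₀
  have hC₀top : C₀ ≠ ∞ := ENNReal.rpow_ne_top_of_nonneg (by norm_num) ENNReal.ofReal_ne_top
  have hE : ∀ t ∈ Icc 0 T, eLpNorm (u t) 2 volume ≤ C₀ := fun t ht =>
    eLpNorm_two_le_of_isLerayHopfOn hν.le hlh ht
  -- every `t < T` lies in a closed sub-strip `[0, T']`, `t < T' < T`
  have hsub : ∀ t ∈ Ico 0 T, ∃ T' ∈ Ioo 0 T, t < T' := fun t ht =>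
    ⟨(t + T) / 2, ⟨by linarith [ht.1], by linarith [ht.2]⟩, by linarith [ht.2]⟩
  -- (ii) `u` is a mild solution on `[0, T)` …
  have hmildT : FluidPDE.IsMildNSSolutionOn (Ioc 0 T) ν 0 (u 0) u :=
    isMildNSSolutionOn_of_isLerayHopfOn_holds hν hT hu02 hlh
  have hmild : FluidPDE.IsMildNSSolutionOn (Ico 0 T) ν 0 (u 0) u := by
    refine ⟨fun t ht => ?_, fun t ht => ?_⟩
    · rcases ht.1.eq_or_lt with h0 | hpos
      · rw [← h0]; exact hdiv0
      · exact hmildT.1 t ⟨hpos, ht.2.le⟩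
    · rcases ht.1.eq_or_lt with h0 | hpos
      · rw [← h0]; exact FluidPDE.isMildNSSolutionFrom_zero_iff.2 fun φ _ _ => rfl
      · exact hmildT.2 t ⟨hpos, ht.2.le⟩
  -- … with slices in `L³` …
  have hmem3 : ∀ t ∈ Ico 0 T, MemLp (u t) 3 volume := by
    intro t ht
    obtain ⟨T', hT', htT'⟩ := hsub t ht
    obtain ⟨M, hMb⟩ := hbound T' hT'
    have hle : eLpNorm (u t) 3 volume ^ 3 ≤ ENNReal.ofReal M * C₀ ^ 2 :=
      (eLpNorm_three_pow_le (hslice t ht)).trans (by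
        gcongr
        exacts [eLpNorm_top_le_of_bound (hMb t ⟨ht.1, htT'.le⟩), hE t ⟨ht.1, ht.2.le⟩])
    have hlt : eLpNorm (u t) 3 volume ^ 3 < ∞ :=
      lt_of_le_of_lt hle
        (ENNReal.mul_lt_top ENNReal.ofReal_lt_top (ENNReal.pow_lt_top hC₀top.lt_top))
    exact ⟨hslice t ht, (ENNReal.pow_lt_top_iff.1 hlt).resolve_right (by norm_num)⟩
  -- … strongly `L²`-continuous at positive times (Sather–Serrin with `q = r = ∞` on `(0, T']`) …
  have hC2 : ∀ T' ∈ Ioo 0 T, FluidPDE.ContinuousInLpOn (Ioc 0 T') 2 u := by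
    intro T' hT'
    obtain ⟨M, hMb⟩ := hbound T' hT'
    have htop : FluidPDE.MemLqLp ∞ ∞ u (Ioo 0 T') :=
      memLqLp_top_top_of_bound (fun t ht => hslice t ⟨ht.1, ht.2.trans_lt hT'.2⟩) hMb
    exact continuousInLpOn_two_of_serrin hν hT'.1 (hlh.of_le hT'.2.le) hu02 (q := ∞) (r := ∞)
      (ENNReal.ofNat_lt_top) (by simp [ENNReal.div_top]) htop
  -- … hence continuous into `L³` on `[0, T)`
  have hC3 : FluidPDE.ContinuousInLpOn (Ico 0 T) 3 u := by
    refine ⟨hmem3, fun t₀ ht₀ => ?_⟩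
    obtain ⟨T', hT', ht₀T'⟩ := hsub t₀ ht₀
    obtain ⟨M, hMb⟩ := hbound T' hT'
    -- `L²`-continuity at `t₀` within `[0, T')`
    have h2 : Tendsto (fun t => eLpNorm (u t - u t₀) 2 volume) (𝓝[Ico 0 T'] t₀) (𝓝 0) := by
      rcases ht₀.1.eq_or_lt with h0 | hpos
      · -- `t₀ = 0`: strong attainment of the datum `u 0`
        subst h0
        have hs : Tendsto (fun t => eLpNorm (u t - u 0) 2 volume) (𝓝[Ioo 0 T'] 0) (𝓝 0) :=
          hlh.strong_initial.mono_left (nhdsWithin_mono _ fun t ht => ht.1)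
        have hp : Tendsto (fun t => eLpNorm (u t - u 0) 2 volume) (pure 0) (𝓝 0) := by
          simpa using tendsto_pure_nhds (fun t => eLpNorm (u t - u 0) 2 volume) 0
        rw [← Ioo_insert_left hT'.1, nhdsWithin_insert]
        exact hp.sup hs
      · have hc := ((hC2 T' hT').2 t₀ ⟨hpos, ht₀T'.le⟩).mono_left
          (nhdsWithin_mono t₀ (Ioo_subset_Ioc_self : Ioo 0 T' ⊆ Ioc 0 T'))
        have heq : 𝓝[Ico 0 T'] t₀ = 𝓝[Ioo 0 T'] t₀ := by
          rw [← nhdsWithin_inter_of_mem' (mem_nhdsWithin_of_mem_nhds (Ioi_mem_nhds hpos))]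
          congr 1
          ext s
          exact ⟨fun h => ⟨h.2, h.1.2⟩, fun h => ⟨⟨h.1.le, h.2⟩, h.1⟩⟩
        rwa [heq]
    -- `L³`-continuity within `[0, T')`, then within `[0, T)`
    have h3 := tendsto_eLpNorm_three_of_two (S := Ico 0 T')
      (fun t ht => hslice t ⟨ht.1, ht.2.trans hT'.2⟩)
      (fun t ht x => hMb t (Ico_subset_Icc_self ht) x) ⟨ht₀.1, ht₀T'⟩ h2
    have heq2 : 𝓝[Ico 0 T] t₀ = 𝓝[Ico 0 T'] t₀ := by
      rw [← nhdsWithin_inter_of_mem' (mem_nhdsWithin_of_mem_nhds (Iio_mem_nhds ht₀T'))]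
      congr 1
      ext s
      exact ⟨fun h => ⟨h.1.1, h.2⟩, fun h => ⟨⟨h.1, h.2.trans hT'.2⟩, h.2⟩⟩
    rwa [heq2]
  -- measurability on `(0, T) × ℝ³`
  have hmeasT : AEStronglyMeasurable (uncurry u) (volume.restrict (Ioo 0 T ×ˢ univ)) :=
    (hcont.mono (prod_mono Ioo_subset_Ico_self Subset.rfl)).aestronglyMeasurable
      (measurableSet_Ioo.prod MeasurableSet.univ)
  -- (iii) `T` is the maximal existence time of `u` as a mild `C_t L³` solution: a longer mild
  -- continuation keeps `‖u(t)‖₃` bounded up to `T`, against the `limsup` criterion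
  have hmaxmild : ∀ T' : ℝ, T < T' →
      ∀ v : ℝ → EuclideanSpace ℝ (Fin 3) → EuclideanSpace ℝ (Fin 3),
      FluidPDE.IsMildNSSolutionOn (Ico 0 T') ν 0 (u 0) v →
      FluidPDE.ContinuousInLpOn (Ico 0 T') 3 v →
      AEStronglyMeasurable (uncurry v) (volume.restrict (Ioo 0 T' ×ˢ univ)) → False := by
    intro T' hTT' v hv hvc hvm
    -- uniqueness on `[0, T)`
    have hvm' : AEStronglyMeasurable (uncurry v) (volume.restrict (Ioo 0 T ×ˢ univ)) :=
      hvm.mono_measure (Measure.restrict_mono (prod_mono (Ioo_subset_Ioo_right hTT'.le)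
        Subset.rfl) le_rfl)
    have hae : ∀ t ∈ Ico 0 T, u t =ᵐ[volume] v t :=
      kato_unique_holds hν h₃ hmild (hv.mono (Ico_subset_Ico_right hTT'.le)) hC3
        (hvc.mono (Ico_subset_Ico_right hTT'.le)) hmeasT hvm'
    -- a uniform `L³` bound for `v` on the compact `[0, T] ⊆ [0, T')`
    obtain ⟨M, hM⟩ := hvc.exists_forall_eLpNorm_le (by norm_num) isCompact_Icc
      (Icc_subset_Ico_right hTT')
    have hMu : ∀ t ∈ Ico 0 T, eLpNorm (u t) 3 volume ≤ M := fun t ht => by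
      rw [eLpNorm_congr_ae (hae t ht)]
      exact hM t (Ico_subset_Icc_self ht)
    -- the unboundedness of `‖u(t)‖₃` on `(0, T)`
    obtain ⟨t, ht, hlt⟩ := h16 M
    exact absurd (hMu t ⟨ht.1.le, ht.2⟩) (not_le.2 hlt)
  -- (iv) Lemarié-Rieusset's Thm. 15.5
  exact h15 hν hT h₃ hdiv0 hmild hC3 rfl hmeasT hmaxmild

/-- **`seregin_L3_blowup` from the deep core and two shared facts** (dependency-tracker form):
`seregin_L3_blowup_mild` (Lemarié-Rieusset 2016, Thm. 15.5 = Seregin 2012, Thm. 1.1 for `L³`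
data), `ess_sup_bound` (Escauriaza–Seregin–Šverák 2003, §3 (3.5)–(3.6); shared with the
decomposition of **ns.S08** `ess_endpoint`) and `leray_blowup_rate_top` (**ns.S28**, Leray 1934,
§20 (3.9)). The Kato smoothing fact `mild_L3_smooth` of `seregin_L3_blowup_of_facts` is not
needed on this route. Real proof (`seregin_L3_blowup_of_limsup` with the `limsup` criterion
`ess_limsup_L3_of_ess_sup_bound` at `T' = 0`). [cite: LemarieRieusset2016, Thm. 15.5] [cite: EscauriazaSereginSverak2003, §3 (3.5)–(3.6)] [cite: Leray1934, §20 (3.9)] -/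
theorem seregin_L3_blowup_of_ess (h15 : seregin_L3_blowup_mild) (h36 : ess_sup_bound)
    (hL : leray_blowup_rate_top) : seregin_L3_blowup := by
  intro ν T hν hT u p hmax hlh h₃ hbdd
  exact seregin_L3_blowup_of_limsup h15 hν hT hmax hlh h₃ hbdd fun M =>
    ess_limsup_L3_of_ess_sup_bound h36 hL hν hT hmax hlh h₃ hbdd M (T' := 0) ⟨le_rfl, hT⟩

/-- The same with the facts conjoined (dependency-tracker form). [cite: LemarieRieusset2016, Thm. 15.5] -/
theorem seregin_L3_blowup_of_ess_and
    (h : seregin_L3_blowup_mild ∧ ess_sup_bound ∧ leray_blowup_rate_top) : seregin_L3_blowup :=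
  seregin_L3_blowup_of_ess h.1 h.2.1 h.2.2

end Literature.Analysis.FluidPDE

end
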